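import Mathlib.Algebra.BigOperators.Ring.Finset
import Mathlib.Algebra.BigOperators.Field
import Mathlib.Algebra.Order.BigOperators.Group.Finset
import Mathlib.Algebra.Order.BigOperators.Ring.Finset
import Mathlib.Data.Fintype.BigOperators
import Mathlib.Data.Fintype.Pi
import Mathlib.Data.Finset.Powerset
import Mathlib.Data.Real.Basic
import Mathlib.Tactic.Linarith
import Mathlib.Tactic.Positivity
import Mathlib.Tactic.Ring
import Mathlib.Tactic.FieldSimp
import HarnessLib

/-!
# A tail inequality for sums of `r`-wise independent indicators (the moment method), counting form

Literature / probability — moments. For a family of "evaluations" `ev : Ω → B → V` on a finite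
sample space `Ω` (uniform measure) which is **`r`-wise uniform** — on any set `D` of at most `r`
positions the values are uniform and independent, in the counting sense that every prescription of
values on `D` is met by exactly `|Ω|/|V|^{|D|}` samples (`KWise.Uniform`; the case in point: the
values of a uniformly random polynomial curve of degree `< r` at distinct parameters) — and target
sets `A_b ⊆ V`, the number of hits `X(ω) = #{b | ev ω b ∈ A_b}` concentrates around its mean
`μ = Σ_b |A_b|/|V|`:

* `KWise.sum_pow_le` — the **even central moment bound**
  `Σ_ω (X(ω) − μ)^r ≤ |Ω| · (r/2 + 1) · (r/2)^r · max(1, μ)^{r/2}` (`r` even);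
* **`KWise.card_lower_tail_le`** — the lower tail used by Umans (JCSS 2003, Lemma 16 / Claim 18,
  citing Bellare–Rompel 1994):
  `#{ω | 2·X(ω) ≤ μ} · μ^r ≤ |Ω| · (r/2 + 1) · (r/2)^r · 4^r · max(1, μ)^{r/2}`,
  i.e. `Pr[X ≤ μ/2] ≤ (r/2 + 1) · (r²/μ)^{r/2}` for `μ ≥ 1` (Markov on the `r`-th power).

The constants are those of the direct moment computation (expand `(Σ_b Y_b)^r` for the centred
indicators `Y_b`; a monomial with a position of multiplicity one vanishes by `r`-wise independence;
the others are bounded by `Π_{b ∈ support} p_b`; a support of size `ℓ ≤ r/2` carries at most `ℓʳ`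
monomials, and `Σ_{|D| = ℓ} Π_{b∈D} p_b ≤ μ^ℓ`, `KWise.sum_powersetCard_prod_le_pow`), weaker than
Bellare–Rompel's `8((rμ + r²)/A²)^{r/2}` but of the same shape `(O(r²)/μ)^{r/2}` in the regime
`μ ≫ r²` in which Umans applies Lemma 16 (property (1) of the reference curves, `q ≫ r⁴`). Everything
is a finite sum over `Fintype`s; no measure theory. No named fact.

## References

* M. Bellare, J. Rompel, *Randomness-efficient oblivious sampling*, FOCS 1994, §2, Lemmas 2.2–2.3
  (the `t`-wise independence tail inequality) [BellareRompel1994].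
* C. Umans, *Pseudo-random generators for all hardnesses*, JCSS 67 (2003), Lemma 16 and Claim 18
  [Umans2003].
-/

noncomputable section

namespace Literature.Probability.Moments

open Finset

namespace KWise

variable {Ω B V : Type*} [Fintype Ω] [Fintype B] [DecidableEq B] [Fintype V] [DecidableEq V]

/-! ### `r`-wise uniform families -/

/-- **`r`-wise uniformity** of a family of evaluations `ev : Ω → B → V` (uniform measure on `Ω`):
for every set `D` of at most `r` positions and every prescription of values on `D`, exactly
`|Ω| / |V|^{|D|}` samples take these values there. [cite: BellareRompel1994, §2 (`t`-wise
independent random variables)] -/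
def Uniform (ev : Ω → B → V) (r : ℕ) : Prop :=
  ∀ D : Finset B, D.card ≤ r → ∀ vals : D → V,
    #{ω : Ω | ∀ b : D, ev ω b = vals b} * Fintype.card V ^ D.card = Fintype.card Ω

variable {ev : Ω → B → V} {r : ℕ}

/-- **Factorisation through the joint values**: for an `r`-wise uniform family and a set `D` of at
most `r` positions, the sum over samples of any function of the values on `D` is `|Ω|/|V|^{|D|}` times
the sum over all value assignments. [cite: BellareRompel1994, §2] -/
theorem sum_comp_mul (hU : Uniform ev r) {D : Finset B} (hD : D.card ≤ r) (F : (D → V) → ℝ) :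
    (∑ ω : Ω, F (fun b : D => ev ω b)) * (Fintype.card V : ℝ) ^ D.card =
      Fintype.card Ω * ∑ vals : D → V, F vals := by
  classical
  set τ : Ω → (D → V) := fun ω b => ev ω b with hτ
  have h1 : ∑ ω : Ω, F (τ ω) = ∑ vals : D → V, (#{ω : Ω | τ ω = vals} : ℝ) * F vals := by
    rw [← Finset.sum_fiberwise' (univ : Finset Ω) τ F]
    refine sum_congr rfl fun vals _ => ?_
    rw [sum_const, nsmul_eq_mul]
  have h2 : ∀ vals : D → V, (#{ω : Ω | τ ω = vals} : ℝ) * (Fintype.card V : ℝ) ^ D.card = Fintype.card Ω := by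
    intro vals
    have := hU D hD vals
    have e : (univ.filter fun ω : Ω => τ ω = vals) = univ.filter fun ω : Ω => ∀ b : D, ev ω b = vals b := by
      ext ω; simp [hτ, funext_iff]
    rw [e]; exact_mod_cast this
  rw [h1, sum_mul, mul_sum]
  refine sum_congr rfl fun vals _ => ?_
  rw [mul_right_comm, h2 vals]

/-! ### Centred indicators -/

/-- The centred indicator of `A ⊆ V`: `1_A − |A|/|V|`. [folklore] -/
def yc (A : Finset V) (v : V) : ℝ := (if v ∈ A then 1 else 0) - (A.card : ℝ) / Fintype.card V

section Centred

variable [Nonempty V]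

omit [DecidableEq V] in
/-- `|V| > 0` as a real. [folklore] -/
theorem card_V_pos : (0 : ℝ) < Fintype.card V := by exact_mod_cast Fintype.card_pos

omit [DecidableEq V] in
/-- `0 ≤ |A|/|V| ≤ 1`. [folklore] -/
theorem density_mem_unitInterval (A : Finset V) :
    (0 : ℝ) ≤ (A.card : ℝ) / Fintype.card V ∧ (A.card : ℝ) / Fintype.card V ≤ 1 :=
  ⟨by positivity, by rw [div_le_one (card_V_pos (V := V))]; exact_mod_cast card_le_univ A⟩

/-- Centred indicators sum to zero. [folklore] -/
theorem sum_yc (A : Finset V) : ∑ v : V, yc A v = 0 := by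
  unfold yc
  rw [sum_sub_distrib, sum_boole, sum_const, card_univ, nsmul_eq_mul]
  have := card_V_pos (V := V)
  have e : ((univ.filter fun v : V => v ∈ A).card : ℝ) = A.card := by
    congr 2; ext v; simp
  rw [e]; field_simp; ring

/-- `|1_A − p| ≤ 1`. [folklore] -/
theorem abs_yc_le_one (A : Finset V) (v : V) : |yc A v| ≤ 1 := by
  unfold yc
  obtain ⟨hp0, hp1⟩ := density_mem_unitInterval (V := V) A
  split_ifs <;> rw [abs_le] <;> constructor <;> linarith

/-- The second moment of the centred indicator is at most `|A|`: `Σ_v (1_A − p)² ≤ |A|`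
(it equals `|V| p (1 − p)`). [folklore] -/
theorem sum_yc_sq_le (A : Finset V) : ∑ v : V, yc A v ^ 2 ≤ A.card := by
  have hV := card_V_pos (V := V)
  set p : ℝ := (A.card : ℝ) / Fintype.card V with hp
  obtain ⟨hp0, hp1⟩ := density_mem_unitInterval (V := V) A
  rw [← hp] at hp0 hp1
  -- `Σ_v yc² = Σ_v (1_A (1 - 2p) + p²) = |A| (1 - 2p) + |V| p²`
  have e : ∀ v : V, yc A v ^ 2 = (if v ∈ A then (1 - 2 * p) else 0) + p ^ 2 := by
    intro v; unfold yc; rw [← hp]; split_ifs <;> ring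
  simp_rw [e]
  rw [sum_add_distrib, ← sum_filter, sum_const, sum_const, card_univ, nsmul_eq_mul, nsmul_eq_mul]
  have e2 : ((univ.filter fun v : V => v ∈ A).card : ℝ) = A.card := by congr 2; ext v; simp
  rw [e2]
  have hA : (A.card : ℝ) = p * Fintype.card V := by rw [hp]; field_simp
  rw [hA]
  nlinarith [mul_nonneg hp0 hV.le, sq_nonneg p, mul_nonneg (mul_nonneg hp0 hp0) hV.le]

/-- **Higher moments are dominated by the second**: for `a ≥ 2`, `|Σ_v (1_A − p)^a| ≤ |A|`.
[folklore] -/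
theorem abs_sum_yc_pow_le (A : Finset V) {a : ℕ} (ha : 2 ≤ a) : |∑ v : V, yc A v ^ a| ≤ A.card := by
  refine (abs_sum_le_sum_abs _ _).trans ((sum_le_sum fun v _ => ?_).trans (sum_yc_sq_le A))
  rw [abs_pow, show a = (a - 2) + 2 by omega, pow_add]
  have h1 : |yc A v| ^ (a - 2) ≤ 1 := pow_le_one₀ (abs_nonneg _) (abs_yc_le_one A v)
  rw [sq_abs]
  nlinarith [sq_nonneg (yc A v)]

end Centred

/-! ### The monomials of the expansion -/

section Monomials

variable (ev) (A : B → Finset V)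

/-- The centred indicator of the event "`ev ω b ∈ A_b`". [folklore] -/
def Y (ω : Ω) (b : B) : ℝ := yc (A b) (ev ω b)

/-- The mean number of hits `μ = Σ_b |A_b| / |V|`. [folklore] -/
def mean : ℝ := ∑ b : B, ((A b).card : ℝ) / Fintype.card V

omit [Fintype Ω] [DecidableEq B] in
/-- The number of hits minus its mean is the sum of the centred indicators. [folklore] -/
theorem hits_sub_mean (ω : Ω) :
    (#{b : B | ev ω b ∈ A b} : ℝ) - mean (V := V) A = ∑ b : B, Y ev A ω b := by
  unfold mean Y yc
  rw [sum_sub_distrib, sum_boole]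

variable {ev A}
variable [Nonempty V]

omit [Fintype B] [Nonempty V] in
/-- The multiplicities of a sequence of positions add up to its length. [folklore] -/
theorem sum_mult_eq (s : Fin r → B) : ∑ b ∈ univ.image s, #{t : Fin r | s t = b} = r := by
  rw [Finset.sum_card_fiberwise_eq_card_filter]
  simp

omit [Fintype B] [Nonempty V] in
/-- If all multiplicities of `s : Fin r → B` are at least `2`, its image has at most `r/2` elements.
[folklore] -/
theorem two_mul_card_image_le (s : Fin r → B) (h : ∀ b ∈ univ.image s, 2 ≤ #{t : Fin r | s t = b}) :
    2 * (univ.image s).card ≤ r := by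
  calc 2 * (univ.image s).card = ∑ b ∈ univ.image s, 2 := by rw [sum_const, smul_eq_mul, mul_comm]
    _ ≤ ∑ b ∈ univ.image s, #{t : Fin r | s t = b} := sum_le_sum h
    _ = r := sum_mult_eq s

/-- **The monomial of a sequence of positions vanishes or is small.** For `s : Fin r → B` with
image `D` and multiplicities `a_b`, `Σ_ω Π_t Y(ω, s_t)` is `0` if some `a_b = 1`, and in absolute
value at most `|Ω| · Π_{b ∈ D} |A_b|/|V|` otherwise: by `r`-wise uniformity on the `|D| ≤ r`
positions of `D` the sum factorises into `|Ω| · Π_{b∈D} (|V|⁻¹ Σ_v (1_{A_b} − p_b)^{a_b})`.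
[cite: BellareRompel1994, Lemma 2.2 (proof)] -/
theorem abs_sum_prod_le (hU : Uniform ev r) (s : Fin r → B) :
    |∑ ω : Ω, ∏ t : Fin r, Y ev A ω (s t)| ≤
      if ∀ b ∈ univ.image s, 2 ≤ #{t : Fin r | s t = b} then
        (Fintype.card Ω : ℝ) * ∏ b ∈ univ.image s, ((A b).card : ℝ) / Fintype.card V else 0 := by
  classical
  set D : Finset B := univ.image s with hD
  have hDr : D.card ≤ r := by rw [hD]; exact card_image_le.trans (by simp)
  set mult : B → ℕ := fun b => #{t : Fin r | s t = b} with hmult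
  -- the monomial as a product over `D`
  have hmon : ∀ ω : Ω, ∏ t : Fin r, Y ev A ω (s t) = ∏ b : D, yc (A b) (ev ω b) ^ mult b := by
    intro ω
    rw [Finset.prod_comp, ← hD, ← Finset.prod_coe_sort D]
    rfl
  simp_rw [hmon]
  -- factorise through the values on `D`
  have hfac := sum_comp_mul hU hDr (fun vals : D → V => ∏ b : D, yc (A b) (vals b) ^ mult b)
  have hVk : (0 : ℝ) < (Fintype.card V : ℝ) ^ D.card := pow_pos card_V_pos _
  have hsum : ∑ ω : Ω, ∏ b : D, yc (A b) (ev ω b) ^ mult b =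
      Fintype.card Ω * (∏ b : D, ∑ v : V, yc (A b) v ^ mult b) / (Fintype.card V : ℝ) ^ D.card := by
    rw [eq_div_iff hVk.ne', hfac]
    congr 1
    rw [Finset.prod_univ_sum (fun _ : D => (univ : Finset V)) (fun b v => yc (A b) v ^ mult b),
      Fintype.piFinset_univ]
  rw [hsum]
  split_ifs with hall
  · -- all multiplicities `≥ 2`: bound each moment by `|A_b|`
    rw [abs_div, abs_mul, abs_of_nonneg (Nat.cast_nonneg _), abs_of_pos hVk, div_le_iff₀ hVk,
      Finset.abs_prod]
    have hprod : ∏ b : D, |∑ v : V, yc (A b) v ^ mult b| ≤ ∏ b : D, ((A (b : B)).card : ℝ) :=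
      prod_le_prod (fun b _ => abs_nonneg _) fun b _ => abs_sum_yc_pow_le (A b) (hall b b.2)
    calc (Fintype.card Ω : ℝ) * ∏ b : D, |∑ v : V, yc (A b) v ^ mult b|
        ≤ Fintype.card Ω * ∏ b : D, ((A (b : B)).card : ℝ) := mul_le_mul_of_nonneg_left hprod (Nat.cast_nonneg _)
      _ = Fintype.card Ω * (∏ b ∈ D, ((A b).card : ℝ) / Fintype.card V) * (Fintype.card V : ℝ) ^ D.card := by
        rw [mul_assoc]
        congr 1
        have e1 : (Fintype.card V : ℝ) ^ D.card = ∏ _b ∈ D, (Fintype.card V : ℝ) := by rw [prod_const]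
        rw [e1, ← prod_mul_distrib, Finset.prod_coe_sort D (fun b => ((A b).card : ℝ))]
        refine prod_congr rfl fun b _ => ?_
        rw [div_mul_cancel₀ _ card_V_pos.ne']
  · -- some multiplicity is `1` (it is never `0` on the image): the moment vanishes
    push Not at hall
    obtain ⟨b, hb, hlt⟩ := hall
    have hpos : 1 ≤ #{t : Fin r | s t = b} := by
      obtain ⟨t, -, rfl⟩ := mem_image.1 hb
      exact card_pos.2 ⟨t, by simp⟩
    have h1 : mult b = 1 := by
      show #{t : Fin r | s t = b} = 1
      omega
    have hzero : ∏ b' : D, ∑ v : V, yc (A b') v ^ mult b' = 0 := by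
      refine prod_eq_zero (mem_univ ⟨b, hb⟩) ?_
      simp only [h1, pow_one]
      exact sum_yc (A b)
    rw [hzero, mul_zero, zero_div, abs_zero]

end Monomials

/-! ### The elementary symmetric bound `Σ_{|D| = ℓ} Π_{b∈D} p_b ≤ (Σ_b p_b)^ℓ` -/

/-- For nonnegative weights, the `ℓ`-th elementary symmetric function is at most the `ℓ`-th power of
the sum: `Σ_{D ⊆ s, |D| = ℓ} Π_{b∈D} p_b ≤ (Σ_{b∈s} p_b)^ℓ`. [folklore] -/
theorem sum_powersetCard_prod_le_pow {ι : Type*} [DecidableEq ι] (p : ι → ℝ) (hp : ∀ i, 0 ≤ p i) :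
    ∀ (s : Finset ι) (ℓ : ℕ), ∑ D ∈ s.powersetCard ℓ, ∏ b ∈ D, p b ≤ (∑ b ∈ s, p b) ^ ℓ := by
  intro s
  induction s using Finset.induction_on with
  | empty =>
    intro ℓ
    cases ℓ with
    | zero => simp
    | succ ℓ => rw [Finset.powersetCard_eq_empty.2 (by simp)]; simp
  | @insert a s ha ih =>
    intro ℓ
    cases ℓ with
    | zero => simp
    | succ ℓ =>
      rw [powersetCard_succ_insert ha, sum_union, sum_insert ha]
      · have h1 := ih (ℓ + 1)
        have h2 := ih ℓ
        have h3 : ∑ D ∈ (s.powersetCard ℓ).image (insert a), ∏ b ∈ D, p b =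
            p a * ∑ D ∈ s.powersetCard ℓ, ∏ b ∈ D, p b := by
          rw [sum_image, mul_sum]
          · refine sum_congr rfl fun D hD => ?_
            have haD : a ∉ D := fun h => ha (mem_powersetCard.1 hD |>.1 h)
            rw [prod_insert haD]
          · intro D hD D' hD' h
            have haD : a ∉ D := fun h' => ha (mem_powersetCard.1 hD |>.1 h')
            have haD' : a ∉ D' := fun h' => ha (mem_powersetCard.1 hD' |>.1 h')
            rw [← erase_insert haD, h, erase_insert haD']
        rw [h3]
        have hS : 0 ≤ ∑ b ∈ s, p b := sum_nonneg fun b _ => hp b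
        have hpa := hp a
        -- `(p_a + S)^{ℓ+1} ≥ S^{ℓ+1} + p_a S^ℓ`
        have key : (∑ b ∈ s, p b) ^ (ℓ + 1) + p a * (∑ b ∈ s, p b) ^ ℓ ≤ (p a + ∑ b ∈ s, p b) ^ (ℓ + 1) := by
          rw [pow_succ, pow_succ]
          have hle : (∑ b ∈ s, p b) ^ ℓ ≤ (p a + ∑ b ∈ s, p b) ^ ℓ :=
            pow_le_pow_left₀ hS (by linarith) ℓ
          nlinarith [pow_nonneg hS ℓ, pow_nonneg (show 0 ≤ p a + ∑ b ∈ s, p b by linarith) ℓ]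
        nlinarith [h1, h2, key, hpa]
      · rw [disjoint_left]
        intro D hD hD'
        obtain ⟨D', hD'', rfl⟩ := mem_image.1 hD'
        exact ha ((mem_powersetCard.1 hD).1 (mem_insert_self a D'))

/-! ### The moment bound and the tail -/

section Tail

variable [Nonempty V] {A : B → Finset V}

/-- Positions images of a given size: the sequences `s : Fin r → B` with image exactly `D` number
at most `|D|^r`. [folklore] -/
theorem card_image_eq_le (D : Finset B) :
    #{s : Fin r → B | univ.image s = D} ≤ D.card ^ r := by
  classical
  calc #{s : Fin r → B | univ.image s = D} ≤ (Fintype.piFinset fun _ : Fin r => D).card := by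
        refine card_le_card fun s hs => ?_
        simp only [mem_filter, mem_univ, true_and] at hs
        rw [Fintype.mem_piFinset]
        intro t; rw [← hs]; exact mem_image_of_mem _ (mem_univ t)
    _ = D.card ^ r := Fintype.card_piFinset_const D r

/-- **The even central moment bound**: for an `r`-wise uniform family and `r` even,
`Σ_ω (X(ω) − μ)^r ≤ |Ω| · (r/2)^r · Σ_{ℓ ≤ r/2} μ^ℓ ≤ |Ω| · (r/2 + 1) · (r/2)^r · max(1, μ)^{r/2}`.
[cite: BellareRompel1994, Lemma 2.2; Umans2003, Lemma 16] -/
theorem sum_pow_le (hU : Uniform ev r) (A : B → Finset V) :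
    ∑ ω : Ω, ((#{b : B | ev ω b ∈ A b} : ℝ) - mean (V := V) A) ^ r ≤
      Fintype.card Ω * (((r / 2 : ℕ) + 1 : ℝ) * ((r / 2 : ℕ) : ℝ) ^ r * max 1 (mean (V := V) A) ^ (r / 2)) := by
  classical
  set μ := mean (V := V) A with hμ
  set p : B → ℝ := fun b => ((A b).card : ℝ) / Fintype.card V with hp
  have hp0 : ∀ b, 0 ≤ p b := fun b => by positivity
  have hμp : μ = ∑ b, p b := rfl
  have hμ0 : 0 ≤ μ := sum_nonneg fun b _ => hp0 b
  -- expand the power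
  have hexp : ∀ ω : Ω, ((#{b : B | ev ω b ∈ A b} : ℝ) - μ) ^ r = ∑ s : Fin r → B, ∏ t, Y ev A ω (s t) := by
    intro ω
    rw [hits_sub_mean, Finset.sum_pow', Fintype.piFinset_univ]
  simp_rw [hexp]
  rw [Finset.sum_comm]
  -- bound each monomial
  have hbound : ∀ s : Fin r → B, ∑ ω : Ω, ∏ t, Y ev A ω (s t) ≤
      Fintype.card Ω * (if 2 * (univ.image s).card ≤ r then ∏ b ∈ univ.image s, p b else 0) := by
    intro s
    refine (le_abs_self _).trans ((abs_sum_prod_le hU s).trans ?_)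
    split_ifs with h1 h2 h2
    · rfl
    · exact absurd (two_mul_card_image_le s h1) h2
    · exact mul_nonneg (Nat.cast_nonneg _) (prod_nonneg fun b _ => hp0 b)
    · rw [mul_zero]
  refine (sum_le_sum fun s _ => hbound s).trans ?_
  rw [← mul_sum]
  refine mul_le_mul_of_nonneg_left ?_ (Nat.cast_nonneg _)
  -- group the sequences by their image
  rw [← Finset.sum_fiberwise' (univ : Finset (Fin r → B)) (fun s => univ.image s)
    (fun D => if 2 * D.card ≤ r then ∏ b ∈ D, p b else 0)]
  have hfib : ∀ D : Finset B, ∑ s ∈ univ.filter (fun s : Fin r → B => univ.image s = D),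
      (if 2 * D.card ≤ r then ∏ b ∈ D, p b else 0) ≤
        if 2 * D.card ≤ r then ((r / 2 : ℕ) : ℝ) ^ r * ∏ b ∈ D, p b else 0 := by
    intro D
    rw [sum_const, nsmul_eq_mul]
    split_ifs with h
    · refine mul_le_mul_of_nonneg_right ?_ (prod_nonneg fun b _ => hp0 b)
      calc ((univ.filter fun s : Fin r → B => univ.image s = D).card : ℝ) ≤ (D.card : ℝ) ^ r := by
            exact_mod_cast card_image_eq_le D
        _ ≤ ((r / 2 : ℕ) : ℝ) ^ r := by
            refine pow_le_pow_left₀ (Nat.cast_nonneg _) ?_ r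
            exact_mod_cast (show D.card ≤ r / 2 by omega)
    · rw [mul_zero]
  refine (sum_le_sum fun D _ => hfib D).trans ?_
  -- sum over the sets of size `ℓ ≤ r/2`
  have hsplit : ∑ D : Finset B, (if 2 * D.card ≤ r then ((r / 2 : ℕ) : ℝ) ^ r * ∏ b ∈ D, p b else 0) =
      ((r / 2 : ℕ) : ℝ) ^ r * ∑ ℓ ∈ range (r / 2 + 1), ∑ D ∈ (univ : Finset B).powersetCard ℓ, ∏ b ∈ D, p b := by
    rw [mul_sum]
    simp_rw [mul_sum]
    rw [← sum_filter]
    have e : (univ.filter fun D : Finset B => 2 * D.card ≤ r) =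
        (range (r / 2 + 1)).biUnion fun ℓ => (univ : Finset B).powersetCard ℓ := by
      ext D
      simp only [mem_filter, mem_univ, true_and, mem_biUnion, mem_range, mem_powersetCard, subset_univ]
      constructor
      · intro h; exact ⟨D.card, by omega, rfl⟩
      · rintro ⟨ℓ, hℓ, hD⟩; omega
    rw [e, sum_biUnion]
    · intro ℓ _ ℓ' _ hne
      simp only [Function.onFun]
      rw [disjoint_left]
      intro D h1 h2
      exact hne ((mem_powersetCard.1 h1).2.symm.trans (mem_powersetCard.1 h2).2)
  rw [hsplit]
  have hes : ∀ ℓ ∈ range (r / 2 + 1), ∑ D ∈ (univ : Finset B).powersetCard ℓ, ∏ b ∈ D, p b ≤ max 1 μ ^ (r / 2) := by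
    intro ℓ hℓ
    refine (sum_powersetCard_prod_le_pow p hp0 univ ℓ).trans ?_
    rw [← hμp]
    calc μ ^ ℓ ≤ max 1 μ ^ ℓ := pow_le_pow_left₀ hμ0 (le_max_right _ _) ℓ
      _ ≤ max 1 μ ^ (r / 2) := pow_le_pow_right₀ (le_max_left _ _) (by have := mem_range.1 hℓ; omega)
  calc ((r / 2 : ℕ) : ℝ) ^ r * ∑ ℓ ∈ range (r / 2 + 1), ∑ D ∈ (univ : Finset B).powersetCard ℓ, ∏ b ∈ D, p b
      ≤ ((r / 2 : ℕ) : ℝ) ^ r * ∑ _ℓ ∈ range (r / 2 + 1), max 1 μ ^ (r / 2) :=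
        mul_le_mul_of_nonneg_left (sum_le_sum hes) (by positivity)
    _ = (((r / 2 : ℕ) : ℝ) + 1) * ((r / 2 : ℕ) : ℝ) ^ r * max 1 μ ^ (r / 2) := by
        rw [sum_const, card_range, nsmul_eq_mul]; push_cast; ring

omit [DecidableEq B] [Nonempty V] in
/-- **Markov on the `r`-th power** (`r` even): `#{ω | a ≤ |X(ω) − μ|} · a^r ≤ Σ_ω (X(ω) − μ)^r`.
[folklore] -/
theorem card_le_of_moment (hr : Even r) (A : B → Finset V) {a : ℝ} (ha : 0 ≤ a) :
    (#{ω : Ω | a ≤ |(#{b : B | ev ω b ∈ A b} : ℝ) - mean (V := V) A|} : ℝ) * a ^ r ≤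
      ∑ ω : Ω, ((#{b : B | ev ω b ∈ A b} : ℝ) - mean (V := V) A) ^ r := by
  classical
  set T : Ω → ℝ := fun ω => (#{b : B | ev ω b ∈ A b} : ℝ) - mean (V := V) A with hT
  have hnn : ∀ ω, 0 ≤ T ω ^ r := fun ω => hr.pow_nonneg _
  calc (#{ω : Ω | a ≤ |T ω|} : ℝ) * a ^ r = ∑ ω ∈ univ.filter (fun ω : Ω => a ≤ |T ω|), a ^ r := by
        rw [sum_const, nsmul_eq_mul]
    _ ≤ ∑ ω ∈ univ.filter (fun ω : Ω => a ≤ |T ω|), T ω ^ r := by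
        refine sum_le_sum fun ω hω => ?_
        have h1 : a ≤ |T ω| := (mem_filter.1 hω).2
        calc a ^ r ≤ |T ω| ^ r := pow_le_pow_left₀ ha h1 r
          _ = T ω ^ r := hr.pow_abs _
    _ ≤ ∑ ω, T ω ^ r := sum_le_sum_of_subset_of_nonneg (filter_subset _ _) fun ω _ _ => hnn ω

/-- **The lower tail (Umans' Lemma 16 / Claim 18 use of Bellare–Rompel), counting form.** For an
`r`-wise uniform family with `r` even, the samples with at most half the expected number of hits are
few: `#{ω | 2·X(ω) ≤ μ} · μ^r ≤ |Ω| · 2^r · (r/2 + 1) · (r/2)^r · max(1, μ)^{r/2}` — for `μ ≥ 1`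
this is `Pr[X ≤ μ/2] ≤ (r/2 + 1) · (r²/μ)^{r/2}`. [cite: Umans2003, Lemma 16 and Claim 18;
BellareRompel1994, Lemma 2.3] -/
theorem card_lower_tail_le (hU : Uniform ev r) (hr : Even r) (A : B → Finset V) :
    (#{ω : Ω | 2 * (#{b : B | ev ω b ∈ A b} : ℝ) ≤ mean (V := V) A} : ℝ) * mean (V := V) A ^ r ≤
      Fintype.card Ω * (2 ^ r * (((r / 2 : ℕ) + 1 : ℝ) * ((r / 2 : ℕ) : ℝ) ^ r *
        max 1 (mean (V := V) A) ^ (r / 2))) := by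
  classical
  set μ := mean (V := V) A with hμ
  have hμ0 : 0 ≤ μ := sum_nonneg fun b _ => by positivity
  have h1 := card_le_of_moment (ev := ev) hr A (a := μ / 2) (by positivity)
  have h2 := sum_pow_le hU A
  rw [← hμ] at h1 h2
  -- the lower-tail event implies the deviation event
  have hsub : (univ.filter fun ω : Ω => 2 * (#{b : B | ev ω b ∈ A b} : ℝ) ≤ μ) ⊆
      univ.filter fun ω : Ω => μ / 2 ≤ |(#{b : B | ev ω b ∈ A b} : ℝ) - μ| := by
    intro ω hω
    simp only [mem_filter, mem_univ, true_and] at hω ⊢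
    rw [abs_sub_comm]
    exact le_trans (by linarith) (le_abs_self _)
  have hcard : (#{ω : Ω | 2 * (#{b : B | ev ω b ∈ A b} : ℝ) ≤ μ} : ℝ) ≤
      #{ω : Ω | μ / 2 ≤ |(#{b : B | ev ω b ∈ A b} : ℝ) - μ|} := by exact_mod_cast card_le_card hsub
  have e : μ ^ r = 2 ^ r * (μ / 2) ^ r := by rw [← mul_pow]; congr 1; ring
  rw [e]
  calc (#{ω : Ω | 2 * (#{b : B | ev ω b ∈ A b} : ℝ) ≤ μ} : ℝ) * (2 ^ r * (μ / 2) ^ r)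
      = 2 ^ r * ((#{ω : Ω | 2 * (#{b : B | ev ω b ∈ A b} : ℝ) ≤ μ} : ℝ) * (μ / 2) ^ r) := by ring
    _ ≤ 2 ^ r * ((#{ω : Ω | μ / 2 ≤ |(#{b : B | ev ω b ∈ A b} : ℝ) - μ|} : ℝ) * (μ / 2) ^ r) :=
        mul_le_mul_of_nonneg_left (mul_le_mul_of_nonneg_right hcard (by positivity)) (by positivity)
    _ ≤ 2 ^ r * (Fintype.card Ω * (((r / 2 : ℕ) + 1 : ℝ) * ((r / 2 : ℕ) : ℝ) ^ r * max 1 μ ^ (r / 2))) :=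
        mul_le_mul_of_nonneg_left (h1.trans h2) (by positivity)
    _ = _ := by ring

end Tail

end KWise

end Literature.Probability.Moments

end
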